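import Summits.QuantumFields.YangMills.Theorems.BalabanLadderUVSeamRecPolymerData
import HarnessLib

/-!
# Crux `UVSeamRec` (stmt-QuantumFields-20043), slot `stub_ceilings` (E0′): the POLYMER DATA of the tempered architecture, II —
# the linear influence functional `I = Σ_γ (b^k/dist)⁴ · 1_{E_γ}`, the tempered class `{I < θ}`, and the shapes consumed by
# ceilings-p2's `PolymerRarity.momentBounds6_of_temperedLaw_and_polymerLaw` (p528131)

Definition file (`--kind definition --supports stmt-QuantumFields-20043 --as helper`) of the unit `ym-20043-tempered-d1`, sibling of
`…PolymerData.lean` (chart, `blockField`, `Polymer`, `influenceCoeff`, `shell`, `largeFieldEvent`).  HONEST FRAMING: definitions and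
order/measurability bookkeeping only; the tempered centre law (a) on `goodTempered … θ` and the polymer product law (PL) for the events
`largeFieldEvent` are OPEN renormalisation-group statements (the two stubs of the v5 shape of `stub_ceilings`, owner R86e (1)); nothing
of them, nothing of E0′ is asserted here.  Not a gap, not Clay.

CONTENTS.  §1 the linear influence functional `influence 𝔟 ε kmax R x η = Σ_{γ ∈ shell} c_γ(x) · 1_{E_γ}(η)` of the exterior shell of
the radius-`(R+1)` cube around `x` (per-level thresholds `ε k`, levels `≤ kmax`), `0 ≤ I ≤ coeffMass`, measurability; the TEMPERED CLASS
`goodTempered … θ = {I < θ}` — the sub-level set of the linear influence functional, no bespoke class (owner R86e (2)) — measurable,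
monotone in `θ`, empty for `θ ≤ 0`, everything for `θ > coeffMass` (the `∀`-exterior corner), complement `= {θ ≤ I}` (the `Bad` event of
seam-s2's defect collar p518354/p519295).  §2 the letters of p528131: `influenceAt 𝔟 ε kmax β R q x` (`I β R q x`, thresholds `ε β k`,
cutoff `kmax β R`; `hIm`, `hIb`), the family shell `S` and family coefficients `c_{iγ}` of a finite family of cube centres, and
DOMINATION (i) of (PL) as an IDENTITY (`influence_eq_familySum`, `influenceAt_le_familySum` — the exact inequality p528131 asks for,
with `E_γ := largeFieldEvent`).  For the CANONICAL polymer system (`S := familyShell`, `c := familyCoeff`) clause (ii) `Σ_i c_{iγ} ≤ Λ` holds with `Λ := 1`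
for every cyclically `2R+4`-separated cube family (`sum_familyCoeff_le_one`: pigeonhole on the 16 orthants around the anchor, `c ≤ 1/16`
on the shell).  The remaining (PL) clauses — weights `w_γ ≥ 0`, the budget `Σ_γ c_{iγ} w_γ ≤ W`, the product law — are the stub's
(hypotheses-to-be-supplied, owner R86e (2)).
-/

set_option autoImplicit false

noncomputable section

open MeasureTheory
open Literature.MathematicalPhysics.QuantumFieldTheory (GaugeConfig)
open Literature.MathematicalPhysics.QuantumFieldTheory.Balaban1983to89
open Literature.MathematicalPhysics.QuantumLattice (LGConfig torusLift)

namespace Summit.QuantumFields.YangMills.Cruxes.UVSeamRec.PolymerData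
/-! ## §1 The linear influence functional and the tempered class -/

section Influence

variable {N : ℕ} [NeZero N]

/-- **THE LINEAR INFLUENCE FUNCTIONAL** of the exterior of the radius-`(R+1)` cube around `x` (block size `b`, per-level thresholds
`ε k`, levels `≤ kmax`): `I(η) = Σ_{γ ∈ shell} (b^k/dist_∞(x, b^k y))⁴ · 1_{E_γ}(η)` — the total influence on `x` of the large-field
polymers of `η` in the shell (owner R86e (2): the functional whose sub-level sets are the tempered class; ceilings-p2's `I_i`). -/
def influence (𝔟 : BlockSize) (ε : ℕ → ℝ) (kmax R : ℕ) (x : Fin 4 → ℤ)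
    (η : LGConfig 4 (Matrix.specialUnitaryGroup (Fin N) ℂ)) : ℝ :=
  ∑ γ ∈ shell 𝔟 kmax R x, influenceCoeff 𝔟 γ x * (largeFieldEvent (N := N) 𝔟 (ε γ.k) γ).indicator (fun _ => (1 : ℝ)) η

/-- The total COEFFICIENT MASS of the shell, `Σ_{γ ∈ shell} c_γ(x)` — the value of the influence functional on a configuration all
of whose shell polymers are large-field; a bound for `I`. -/
def coeffMass (𝔟 : BlockSize) (kmax R : ℕ) (x : Fin 4 → ℤ) : ℝ :=
  ∑ γ ∈ shell 𝔟 kmax R x, influenceCoeff 𝔟 γ x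

/-- The influence functional is nonnegative. -/
theorem influence_nonneg (𝔟 : BlockSize) (ε : ℕ → ℝ) (kmax R : ℕ) (x : Fin 4 → ℤ)
    (η : LGConfig 4 (Matrix.specialUnitaryGroup (Fin N) ℂ)) : 0 ≤ influence (N := N) 𝔟 ε kmax R x η :=
  Finset.sum_nonneg fun γ _ =>
    mul_nonneg (influenceCoeff_nonneg 𝔟 γ x) (Set.indicator_nonneg (fun _ _ => zero_le_one) _)

/-- The influence functional is bounded by the coefficient mass of the shell. -/
theorem influence_le_coeffMass (𝔟 : BlockSize) (ε : ℕ → ℝ) (kmax R : ℕ) (x : Fin 4 → ℤ)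
    (η : LGConfig 4 (Matrix.specialUnitaryGroup (Fin N) ℂ)) :
    influence (N := N) 𝔟 ε kmax R x η ≤ coeffMass 𝔟 kmax R x := by
  refine Finset.sum_le_sum fun γ _ => ?_
  have h1 : (largeFieldEvent (N := N) 𝔟 (ε γ.k) γ).indicator (fun _ => (1 : ℝ)) η ≤ 1 :=
    Set.indicator_apply_le' (fun _ => le_rfl) (fun _ => zero_le_one)
  simpa using mul_le_mul_of_nonneg_left h1 (influenceCoeff_nonneg 𝔟 γ x)

/-- `|I| ≤ coeffMass` (the form `hIb` of ceilings-p2's `rarity_of_expMoment`). -/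
theorem abs_influence_le_coeffMass (𝔟 : BlockSize) (ε : ℕ → ℝ) (kmax R : ℕ) (x : Fin 4 → ℤ)
    (η : LGConfig 4 (Matrix.specialUnitaryGroup (Fin N) ℂ)) :
    |influence (N := N) 𝔟 ε kmax R x η| ≤ coeffMass 𝔟 kmax R x := by
  rw [abs_of_nonneg (influence_nonneg 𝔟 ε kmax R x η)]
  exact influence_le_coeffMass 𝔟 ε kmax R x η

/-- The coefficient mass is nonnegative. -/
theorem coeffMass_nonneg (𝔟 : BlockSize) (kmax R : ℕ) (x : Fin 4 → ℤ) : 0 ≤ coeffMass 𝔟 kmax R x :=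
  Finset.sum_nonneg fun γ _ => influenceCoeff_nonneg 𝔟 γ x

/-- The influence functional is measurable. -/
theorem measurable_influence (𝔟 : BlockSize) (ε : ℕ → ℝ) (kmax R : ℕ) (x : Fin 4 → ℤ) :
    Measurable (influence (N := N) 𝔟 ε kmax R x) := by
  refine Finset.measurable_sum _ fun γ _ => ?_
  exact (measurable_const.indicator (measurableSet_largeFieldEvent (N := N) 𝔟 (ε γ.k) γ)).const_mul _

/-- **THE TEMPERED CLASS** at threshold `θ`: the sub-level set `{η | I(η) < θ}` of the linear influence functional — exteriors whose
large-field polymers (levels `≤ kmax`, thresholds `ε`) exert total influence `< θ` on the centre `x` (owner R86e (2): no bespoke class;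
this is the `Good β R q x` of seam-s2's defect collar p519295 and ceilings-p2's p528131). -/
def goodTempered (𝔟 : BlockSize) (ε : ℕ → ℝ) (kmax R : ℕ) (x : Fin 4 → ℤ) (θ : ℝ) :
    Set (LGConfig 4 (Matrix.specialUnitaryGroup (Fin N) ℂ)) :=
  {η | influence (N := N) 𝔟 ε kmax R x η < θ}

/-- The tempered class is measurable. -/
theorem measurableSet_goodTempered (𝔟 : BlockSize) (ε : ℕ → ℝ) (kmax R : ℕ) (x : Fin 4 → ℤ) (θ : ℝ) :
    MeasurableSet (goodTempered (N := N) 𝔟 ε kmax R x θ) :=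
  measurableSet_lt (measurable_influence (N := N) 𝔟 ε kmax R x) measurable_const

/-- The tempered class grows with the threshold. -/
theorem goodTempered_mono (𝔟 : BlockSize) (ε : ℕ → ℝ) (kmax R : ℕ) (x : Fin 4 → ℤ) {θ θ' : ℝ} (h : θ ≤ θ') :
    goodTempered (N := N) 𝔟 ε kmax R x θ ⊆ goodTempered (N := N) 𝔟 ε kmax R x θ' :=
  fun _ hη => lt_of_lt_of_le hη h

/-- The tempered class is empty for `θ ≤ 0` (influence is nonnegative) … -/
theorem goodTempered_eq_empty_of_nonpos (𝔟 : BlockSize) (ε : ℕ → ℝ) (kmax R : ℕ) (x : Fin 4 → ℤ) {θ : ℝ}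
    (h : θ ≤ 0) : goodTempered (N := N) 𝔟 ε kmax R x θ = ∅ := by
  ext η
  simp only [goodTempered, Set.mem_setOf_eq, Set.mem_empty_iff_false, iff_false, not_lt]
  exact h.trans (influence_nonneg 𝔟 ε kmax R x η)

/-- … and everything once `θ` exceeds the coefficient mass (the `∀`-exterior corner of the tempered law). -/
theorem goodTempered_eq_univ_of_coeffMass_lt (𝔟 : BlockSize) (ε : ℕ → ℝ) (kmax R : ℕ) (x : Fin 4 → ℤ) {θ : ℝ}
    (h : coeffMass 𝔟 kmax R x < θ) : goodTempered (N := N) 𝔟 ε kmax R x θ = Set.univ := by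
  ext η
  simp only [goodTempered, Set.mem_setOf_eq, Set.mem_univ, iff_true]
  exact lt_of_le_of_lt (influence_le_coeffMass 𝔟 ε kmax R x η) h

/-- The complement of the tempered class is the super-level set `{θ ≤ I}` (the `Bad` event of the defect collar). -/
theorem compl_goodTempered (𝔟 : BlockSize) (ε : ℕ → ℝ) (kmax R : ℕ) (x : Fin 4 → ℤ) (θ : ℝ) :
    (goodTempered (N := N) 𝔟 ε kmax R x θ)ᶜ = {η | θ ≤ influence (N := N) 𝔟 ε kmax R x η} := by
  ext η
  simp [goodTempered, not_lt]

end Influence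

/-! ## §2 The shapes consumed by `PolymerRarity.momentBounds6_of_temperedLaw_and_polymerLaw` (p528131) -/

section Consumption

variable {N : ℕ} [NeZero N]

/-- The influence functional in the letters of p528131, `I β R q x : LGConfig 4 SU(N) → ℝ`: block size `b`, per-level thresholds
`ε β k`, level cutoff `kmax β R`; the orientation `q` of the central plane is not used (one tempered class for all six planes). -/
def influenceAt (𝔟 : BlockSize) (ε : ℝ → ℕ → ℝ) (kmax : ℝ → ℕ → ℕ) (β : ℝ) (R : ℕ) (_q : Fin 4 × Fin 4)
    (x : Fin 4 → ℤ) (η : LGConfig 4 (Matrix.specialUnitaryGroup (Fin N) ℂ)) : ℝ :=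
  influence (N := N) 𝔟 (ε β) (kmax β R) R x η

/-- `influenceAt` unfolded. -/
theorem influenceAt_eq (𝔟 : BlockSize) (ε : ℝ → ℕ → ℝ) (kmax : ℝ → ℕ → ℕ) (β : ℝ) (R : ℕ) (q : Fin 4 × Fin 4)
    (x : Fin 4 → ℤ) (η : LGConfig 4 (Matrix.specialUnitaryGroup (Fin N) ℂ)) :
    influenceAt (N := N) 𝔟 ε kmax β R q x η = influence (N := N) 𝔟 (ε β) (kmax β R) R x η := rfl

/-- `influenceAt` is measurable (hypothesis `hIm` of p528131). -/
theorem measurable_influenceAt (𝔟 : BlockSize) (ε : ℝ → ℕ → ℝ) (kmax : ℝ → ℕ → ℕ) (β : ℝ) (R : ℕ)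
    (q : Fin 4 × Fin 4) (x : Fin 4 → ℤ) : Measurable (influenceAt (N := N) 𝔟 ε kmax β R q x) :=
  measurable_influence (N := N) 𝔟 (ε β) (kmax β R) R x

/-- `|influenceAt| ≤ coeffMass` (hypothesis `hIb` of p528131's `rarity_of_expMoment`, with `M β R := coeffMass b (kmax β R) R x` —
translation-invariant in `x`, see `coeffMass` … the bound is stated pointwise in `x`). -/
theorem abs_influenceAt_le (𝔟 : BlockSize) (ε : ℝ → ℕ → ℝ) (kmax : ℝ → ℕ → ℕ) (β : ℝ) (R : ℕ)
    (q : Fin 4 × Fin 4) (x : Fin 4 → ℤ) (η : LGConfig 4 (Matrix.specialUnitaryGroup (Fin N) ℂ)) :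
    |influenceAt (N := N) 𝔟 ε kmax β R q x η| ≤ coeffMass 𝔟 (kmax β R) R x :=
  abs_influence_le_coeffMass 𝔟 (ε β) (kmax β R) R x η

/-- The sub-level set of `influenceAt` is the tempered class (the `Good := {I < θ}` of p528131). -/
theorem setOf_influenceAt_lt (𝔟 : BlockSize) (ε : ℝ → ℕ → ℝ) (kmax : ℝ → ℕ → ℕ) (β : ℝ) (R : ℕ)
    (q : Fin 4 × Fin 4) (x : Fin 4 → ℤ) (θ : ℝ) :
    {η | influenceAt (N := N) 𝔟 ε kmax β R q x η < θ} = goodTempered (N := N) 𝔟 (ε β) (kmax β R) R x θ := rfl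

/-- The FAMILY SHELL of a finite family of cube centres: the union of their shells (the polymer index set `S` of (PL)). -/
def familyShell (𝔟 : BlockSize) (kmax R : ℕ) {n : ℕ} (x : Fin n → (Fin 4 → ℤ)) : Finset Polymer :=
  Finset.univ.biUnion fun i => shell 𝔟 kmax R (x i)

/-- Each cube's shell is contained in the family shell. -/
theorem shell_subset_familyShell (𝔟 : BlockSize) (kmax R : ℕ) {n : ℕ} (x : Fin n → (Fin 4 → ℤ)) (i : Fin n) :
    shell 𝔟 kmax R (x i) ⊆ familyShell 𝔟 kmax R x :=
  Finset.subset_biUnion_of_mem (fun i => shell 𝔟 kmax R (x i)) (Finset.mem_univ i)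

/-- The FAMILY COEFFICIENTS `c_{iγ}`: the influence coefficient of `γ` on the centre `x i` when `γ` is in the shell of cube `i`, else
`0` (the `c : Fin n → κ → ℝ` of (PL)). -/
def familyCoeff (𝔟 : BlockSize) (kmax R : ℕ) {n : ℕ} (x : Fin n → (Fin 4 → ℤ)) (i : Fin n) (γ : Polymer) : ℝ :=
  if γ ∈ shell 𝔟 kmax R (x i) then influenceCoeff 𝔟 γ (x i) else 0

/-- Family coefficients are nonnegative (hypothesis `(∀ i, ∀ γ ∈ S, 0 ≤ c i γ)` of (PL)). -/
theorem familyCoeff_nonneg (𝔟 : BlockSize) (kmax R : ℕ) {n : ℕ} (x : Fin n → (Fin 4 → ℤ)) (i : Fin n) (γ : Polymer) :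
    0 ≤ familyCoeff 𝔟 kmax R x i γ := by
  unfold familyCoeff
  split_ifs
  · exact influenceCoeff_nonneg 𝔟 γ (x i)
  · exact le_rfl

/-- Family coefficients are at most `1/16`. -/
theorem familyCoeff_le (𝔟 : BlockSize) (kmax R : ℕ) {n : ℕ} (x : Fin n → (Fin 4 → ℤ)) (i : Fin n) (γ : Polymer) :
    familyCoeff 𝔟 kmax R x i γ ≤ 1 / 16 := by
  unfold familyCoeff
  split_ifs with h
  · exact influenceCoeff_le_of_mem_shell h
  · norm_num

/-- **DOMINATION (i) OF (PL) AS AN IDENTITY.**  The influence functional of cube `i` is the linear functional of the large-field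
indicators over the FAMILY shell with the family coefficients:
`I_i(η) = Σ_{γ ∈ familyShell} c_{iγ} · 1_{E_γ}(η)`. -/
theorem influence_eq_familySum (𝔟 : BlockSize) (ε : ℕ → ℝ) (kmax R : ℕ) {n : ℕ} (x : Fin n → (Fin 4 → ℤ)) (i : Fin n)
    (η : LGConfig 4 (Matrix.specialUnitaryGroup (Fin N) ℂ)) :
    influence (N := N) 𝔟 ε kmax R (x i) η =
      ∑ γ ∈ familyShell 𝔟 kmax R x,
        familyCoeff 𝔟 kmax R x i γ * (largeFieldEvent (N := N) 𝔟 (ε γ.k) γ).indicator (fun _ => (1 : ℝ)) η := by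
  have hsub := shell_subset_familyShell 𝔟 kmax R x i
  unfold influence familyCoeff
  rw [← Finset.sum_subset hsub (f := fun γ => (if γ ∈ shell 𝔟 kmax R (x i) then influenceCoeff 𝔟 γ (x i) else 0) *
      (largeFieldEvent (N := N) 𝔟 (ε γ.k) γ).indicator (fun _ => (1 : ℝ)) η)]
  · exact Finset.sum_congr rfl fun γ hγ => by rw [if_pos hγ]
  · intro γ _ hγ
    rw [if_neg hγ, zero_mul]

/-- Domination (i) of (PL) in the exact shape p528131 consumes, on torus configurations read through the periodic lift:
`I β R (q i) (x i) (lift U) ≤ Σ_{γ ∈ S} c i γ · 1_{E_γ}(lift U)` with `S := familyShell`, `c := familyCoeff`, `E_γ := largeFieldEvent`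
(an equality, stated as the inequality the consumer asks for). -/
theorem influenceAt_le_familySum (𝔟 : BlockSize) (ε : ℝ → ℕ → ℝ) (kmax : ℝ → ℕ → ℕ) (β : ℝ) (R L : ℕ) {n : ℕ}
    (q : Fin n → Fin 4 × Fin 4) (x : Fin n → (Fin 4 → ℤ)) (i : Fin n)
    (U : GaugeConfig 4 (2 * L + 1) (Matrix.specialUnitaryGroup (Fin N) ℂ)) :
    influenceAt (N := N) 𝔟 ε kmax β R (q i) (x i) (torusLift (2 * L + 1) U) ≤
      ∑ γ ∈ familyShell 𝔟 (kmax β R) R x, familyCoeff 𝔟 (kmax β R) R x i γ *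
        (largeFieldEvent (N := N) 𝔟 (ε β γ.k) γ).indicator (fun _ => (1 : ℝ)) (torusLift (2 * L + 1) U) :=
  (influence_eq_familySum (N := N) 𝔟 (ε β) (kmax β R) R x i (torusLift (2 * L + 1) U)).le


/-- Cyclic separation on the torus of side `2L+1` implies separation in `ℤ⁴`: `|valMinAbs (m mod (2L+1))| ≤ |m|`. [folklore] -/
theorem abs_valMinAbs_intCast_le (L : ℕ) (m : ℤ) : |(((m : ZMod (2 * L + 1))).valMinAbs : ℤ)| ≤ |m| := by
  rw [Int.abs_eq_natAbs, Int.abs_eq_natAbs]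
  exact_mod_cast ZMod.natAbs_min_of_le_div_two (2 * L + 1) _ m (ZMod.coe_valMinAbs _)
    (ZMod.natAbs_valMinAbs_le _)

/-- **BOOKKEEPING (ii) OF (PL) FOR THE CANONICAL COEFFICIENTS: ONE POLYMER INFLUENCES SEPARATED CUBES WITH TOTAL COEFFICIENT `≤ 1`.**
For a family of cube centres pairwise cyclically `2R+4`-separated in some coordinate (the separation clause of `MomentBounds6`) and ANY
polymer `γ`: `Σ_i c_{iγ} ≤ 1` — at most `2⁴ = 16` of the centres lie within sup-distance `2R+2` of the anchor of `γ` (pigeonhole on the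
`16` orthants around the anchor: two centres in one orthant are within `2R+2` in every coordinate), and each coefficient is `≤ 1/16`
(`familyCoeff_le`).  So `Λ β R := 1` serves clause (ii) for `c := familyCoeff`. [folklore] -/
theorem sum_familyCoeff_le_one (𝔟 : BlockSize) (kmax R : ℕ) {n L : ℕ} (x : Fin n → (Fin 4 → ℤ))
    (hsep : ∀ i j : Fin n, i ≠ j → ∃ k : Fin 4,
      (2 * (R : ℤ) + 4) ≤ |((((x i k - x j k : ℤ) : ZMod (2 * L + 1))).valMinAbs : ℤ)|)
    (γ : Polymer) : ∑ i, familyCoeff 𝔟 kmax R x i γ ≤ 1 := by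
  classical
  -- separation in `ℤ⁴`
  have hsepZ : ∀ i j : Fin n, i ≠ j → ∃ k : Fin 4, (2 * (R : ℤ) + 4) ≤ |x i k - x j k| := by
    intro i j hij
    obtain ⟨k, hk⟩ := hsep i j hij
    exact ⟨k, hk.trans (abs_valMinAbs_intCast_le L _)⟩
  -- the centres whose shell contains `γ`
  set T : Finset (Fin n) := Finset.univ.filter fun i => γ ∈ shell 𝔟 kmax R (x i) with hT
  have hsum : ∑ i, familyCoeff 𝔟 kmax R x i γ = ∑ i ∈ T, influenceCoeff 𝔟 γ (x i) := by
    rw [hT, Finset.sum_filter]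
    rfl
  -- pigeonhole: `T` injects into the `16` orthants around the anchor
  set a : Fin 4 → ℤ := anchor 𝔟 γ with ha
  have hnear : ∀ i ∈ T, ∀ k : Fin 4, |x i k - a k| ≤ 2 * (R : ℤ) + 2 := by
    intro i hi k
    have hi' : γ ∈ shell 𝔟 kmax R (x i) := (Finset.mem_filter.1 hi).2
    have h1 : ((x i k - a k).natAbs : ℤ) ≤ ((2 * R + 2 : ℕ) : ℤ) := by
      exact_mod_cast (natAbs_sub_le_supDist (x i) a k).trans (supDist_le_of_mem_shell hi')
    rw [Int.natCast_natAbs] at h1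
    push_cast at h1
    exact h1
  have hinj : Set.InjOn (fun i : Fin n => fun k : Fin 4 => decide (x i k ≤ a k)) ↑T := by
    intro i hi j hj hfij
    by_contra hij
    obtain ⟨k, hk⟩ := hsepZ i j hij
    have hik := abs_le.1 (hnear i hi k)
    have hjk := abs_le.1 (hnear j hj k)
    have hf : decide (x i k ≤ a k) = decide (x j k ≤ a k) := congr_fun hfij k
    have hiff : (x i k ≤ a k ↔ x j k ≤ a k) := by simpa using hf
    rcases le_or_gt (x i k) (a k) with h | h
    · have h' := hiff.1 h
      have : |x i k - x j k| ≤ 2 * R + 2 := abs_le.2 ⟨by linarith, by linarith⟩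
      linarith
    · have h' : a k < x j k := not_le.1 fun h'' => (not_le.2 h) (hiff.2 h'')
      have : |x i k - x j k| ≤ 2 * R + 2 := abs_le.2 ⟨by linarith, by linarith⟩
      linarith
  have hcard : T.card ≤ 16 := by
    have h := Finset.card_le_card_of_injOn (fun i : Fin n => fun k : Fin 4 => decide (x i k ≤ a k))
      (fun i _ => Finset.mem_univ _) hinj
    simpa using h
  -- assemble
  rw [hsum]
  calc ∑ i ∈ T, influenceCoeff 𝔟 γ (x i) ≤ ∑ _i ∈ T, (1 / 16 : ℝ) :=
        Finset.sum_le_sum fun i hi => influenceCoeff_le_of_mem_shell (Finset.mem_filter.1 hi).2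
    _ = (T.card : ℝ) * (1 / 16) := by rw [Finset.sum_const, nsmul_eq_mul]
    _ ≤ 16 * (1 / 16) := by gcongr; exact_mod_cast hcard
    _ = 1 := by norm_num

/-- Clause (ii) of (PL) in the exact shape p528131 asks for, with `Λ β R := 1`, for the canonical polymer system
(`S := familyShell`, `c := familyCoeff`). [folklore] -/
theorem familyCoeff_clause_ii (𝔟 : BlockSize) (kmax R : ℕ) {n L : ℕ} (x : Fin n → (Fin 4 → ℤ))
    (hsep : ∀ i j : Fin n, i ≠ j → ∃ k : Fin 4,
      (2 * (R : ℤ) + 4) ≤ |((((x i k - x j k : ℤ) : ZMod (2 * L + 1))).valMinAbs : ℤ)|) :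
    ∀ γ ∈ familyShell 𝔟 kmax R x, ∑ i, familyCoeff 𝔟 kmax R x i γ ≤ (1 : ℝ) :=
  fun γ _ => sum_familyCoeff_le_one 𝔟 kmax R x hsep γ

end Consumption

end Summit.QuantumFields.YangMills.Cruxes.UVSeamRec.PolymerData

end
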